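import Summits.BirchSwinnertonDyer.Rank1Residual.X11b.BDPRouteLocalKernelExact
import Summits.BirchSwinnertonDyer.Rank1Residual.X11b.RouteR1LocalKernelPrimeToP
import Literature.NumberTheory.EllipticCurves.AnticyclotomicPrimeDecomposition
import HarnessLib

/-!
# X11b, route R1 — atom (P11) ELIMINATED from the statement of record: `BSD(E,p)` on
# `R1Population` from the nine published facts, FIVE cited facts (four cohomological + Brink 2007)
# and the ONE open input

HONEST FRAMING (cell `b2b-bsdres`, run/shared/lean/b2b/bsd-rank1-residual/, verbatim in every
file): the goal of the cell is to DELETE the COMBINATION-SHAPED residual classes of the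
Birch–Swinnerton-Dyer formula for ALL analytic-rank `≤ 1` elliptic curves over `ℚ` — "full BSD
formula for every rank `≤ 1` curve in class `C`" assembled STRICTLY from published theorems — so
that the rank-`≤ 1` remainder becomes exactly the CONSTRUCTION-SHAPED classes, which are TYPED
(missing-input `Prop`s), NOT attempted. This is not "finishing BSD". Sub-cell
`b2b-bsdres-multr1-p1` (X11b, route R1 = Castella 2018 Thm. A re-proved along the author's
erratum); a RESEARCH ROUTE; no claim beyond the stated class; X11b stays CONSTRUCTION-SHAPED;
nothing here changes a label; no named fact is minted (theorems only; no `sorry`). CONDITIONAL: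
the cited fact `ZpExtension.decomp_not_le_kerSubgroup_of_isAnticyclotomic` (Brink 2007, Math.
Comp. 76, Thm. 2 / Cor. 1: split primes are finitely decomposed in the anticyclotomic tower) and the
four cited cohomological facts of gens 13–17 are hypotheses, as are the nine published named facts of
`R1.bsdp`; the ONE open input `R1OpenInputOnTreeAt` ((IMC)∘(BDP) at `𝟙`, PREPRINT) remains.

## What this file proves

Gen 17 left ONE typed "PUB shape on constructed objects" in route R1's statement of record: the
local Tamagawa atom (P11) `R1LocalKernelOrderAt` (JSW17 Prop. 3.3.4 Case 1(a) / Greenberg LNM 1716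
Lemma 3.3 at a bad place: `#ker r_w = c_w^{(p)}` at every `w ∈ Σ(N⁺)`), consumed off the
locally-trivial pairs. It is now a theorem on the constructed objects at every place finitely decomposed
in `K_∞` — the tree's `localKernelOrderAt_of_not_le` (multr1-p2 gen 20, `BDPRouteLocalKernelExact`:
route p2's bound and purity count squeezed by this sub-cell's exact transport
`natCard_localKer_eq_natCard_quotient_range_decompSubOne`; independently gen 18's
`LocalKernelTamagawaExact` via the `E₀`-part and the `p`-Sylow of `Φ_v`) — and gen 18 typed the
arithmetic input —
"a prime of `K` over a rational prime `ℓ ≠ p` SPLIT in `K` is finitely decomposed in the anticyclotomic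
`ℤ_p`-extension" — as the cited fact `ZpExtension.decomp_not_le_kerSubgroup_of_isAnticyclotomic`
(Brink 2007, Thm. 2 and Cor. 1; class field theory). Here:

* `r1LocalKernelOrderAt_of_anticyclotomicDecomposition` — Brink's fact ⟹ `R1LocalKernelOrderAt W p`
  for every globally minimal `W/ℚ` and every ODD prime `p` (the places of `Σ(N⁺)` lie over primes
  split in `K`, away from `p`);
* `r1ControlOnTreeAt_of_poitouTateAtoms_of_anticyclotomicDecomposition` — (CTL) `R1ControlOnTreeAt`
  (Cas18 Thm. 2.3 at every R1 datum; there `p ≥ 5`) from the three Poitou–Tate atoms and Brink's fact;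
* **`R1.bsdp_of_onTree_final`** — THE STATEMENT OF RECORD: for every globally minimal elliptic `W/ℚ`
  and prime `p` on `R1Population` with `ord_{s=1} L(E,s) = 1`, `BSD(E,p)` follows from the NINE
  PUBLISHED named facts of `R1.bsdp` (Gross–Zagier 1986 I.7.3; GZK over `ℚ`; Skinner 2016 Thm. C;
  modularity; Cai–Shu–Tian 2014 Thm. 1.1; Friedberg–Hoffstein, ramified form; Mazur 1978 on the Manin
  constant; Néron scaling), FIVE CITED facts (Poitou–Tate duality for Selmer structures, Howard 2.1.11
  / Milne I 4.10(b); Poitou–Tate duality of `Ш`; local Euler–Poincaré characteristic, Milne I 2.8;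
  `cd_p(Γ_K) ≤ 2`, Serre II §4.4 Prop. 13; Brink 2007 Thm. 2 / Cor. 1), and the ONE OPEN input
  `R1OpenInputOnTreeAt`. NO typed shape "on constructed objects" remains: Cas18 Thm. 2.3 (the
  `N⁺`-imprimitive anticyclotomic control theorem with its exact Euler-characteristic formula) is a
  tree theorem on route R1's objects modulo cited facts — (P6) gen 17 (with multr1-p2), (P9) gen 15,
  (L10) gen 16, (P11) multr1-p2 gen 20 with gen 18's transport + Brink.

References: [Castella2018] Thm. 2.3, §5 (arXiv:1704.06608 pp. 5, 12); [Castella2018Erratum] Thm. 1.1,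
Thm. A′ (p. 1); [JetchevSkinnerWan2017] Prop. 3.2.1, Thm. 3.3.1, Prop. 3.3.2, Lemma 3.3.3, Prop. 3.3.4
(arXiv:1512.06894 pp. 10–13); [GreenbergLNM1716] §3 Lemma 3.3, §4 pp. 74–75; [Brink2007] Thm. 2,
Cor. 1 (Math. Comp. 76 (2007) pp. 2134–2136).
-/

noncomputable section

open scoped Classical

open WeierstrassCurve NumberField IsDedekindDomain Field
open Literature.NumberTheory.EllipticCurves Literature.NumberTheory.EllipticCurves.GreenbergSelmer
open Literature.NumberTheory.EllipticCurves.ModularForms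
open Literature.NumberTheory.EllipticCurves.Rank1Residual
open Literature.NumberTheory.EllipticCurves.Rank1Residual.Typed
open Literature.NumberTheory.GaloisRepresentations
open Literature.NumberTheory.GaloisCohomology
open Summit.BirchSwinnertonDyer.Rank1Residual.X11b.AcSelmer

namespace Summit.BirchSwinnertonDyer.Rank1Residual.X11b

section ClassLevel

variable (W : WeierstrassCurve ℚ) [W.IsElliptic] [W.IsGloballyMinimal] (p : ℕ) [Fact p.Prime]

omit [W.IsGloballyMinimal] in
/-- **The class-level atom (P11) of route R1 from Brink's prime-decomposition law.** For every
globally minimal elliptic `W/ℚ` and every odd prime `p`: `R1LocalKernelOrderAt W p` — at every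
imaginary quadratic `K`, every anticyclotomic `κ` and every `w ∈ Σ(N⁺)` (a place `w ∤ p` over a prime
`ℓ ∣ N_E` SPLIT in `K`), `#ker(H¹(K_w, E[p^∞]) → H¹(K_{∞,η}, E[p^∞])) = c_w^{(p)}(E/K)`: `w` is finitely
decomposed in `K_∞^{ac}` (Brink 2007), so the exact Greenberg Lemma 3.3 (`localKernelOrderAt_of_not_le`) applies.
[cite: JetchevSkinnerWan2017, Prop. 3.3.4 Case 1(a) (arXiv:1512.06894 pp. 12–13)]
[cite: GreenbergLNM1716, §3 Lemma 3.3 (p. 87) and §4 pp. 74–75] [cite: Brink2007, Thm. 2 and Cor. 1 (pp. 2134–2136)] -/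
theorem r1LocalKernelOrderAt_of_anticyclotomicDecomposition
    (hBr : ∀ (K : Type) [Field K] [NumberField K] (p : ℕ) [Fact p.Prime],
      ZpExtension.decomp_not_le_kerSubgroup_of_isAnticyclotomic K p)
    (hp : p ≠ 2) : R1LocalKernelOrderAt W p := by
  intro K _ _ hK κ hκ v hv
  obtain ⟨hpv, -, he, hf⟩ := (mem_nPlusPlaces_iff v).mp hv
  exact localKernelOrderAt_of_not_le (W.baseChange K) κ hpv (hBr K p hK hp κ hκ v hpv he hf)

/-- **(CTL) at class level from the three Poitou–Tate atoms and Brink's fact**: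
`R1PoitouTateAtomsAt W p → R1ControlOnTreeAt W p` (at an R1 datum `p ≥ 5`, `K` is imaginary
quadratic and `κ` anticyclotomic, so every `w ∈ Σ(N⁺)` is finitely decomposed in `K_∞` and the local
atom (P11) is the tree's `localKernelOrderAt_of_not_le`). [cite: Castella2018, Thm. 2.3 (arXiv:1704.06608 p. 5)]
[cite: JetchevSkinnerWan2017, Thm. 3.3.1 and §3.3 (arXiv:1512.06894 pp. 11–14)] [cite: Brink2007, Thm. 2 and Cor. 1] -/
theorem r1ControlOnTreeAt_of_poitouTateAtoms_of_anticyclotomicDecomposition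
    (hBr : ∀ (K : Type) [Field K] [NumberField K] (p : ℕ) [Fact p.Prime],
      ZpExtension.decomp_not_le_kerSubgroup_of_isAnticyclotomic K p)
    (hPT : R1PoitouTateAtomsAt W p) : R1ControlOnTreeAt W p := by
  intro _ q _ K _ _ Dt H ι P hE hr hqp hmq hns hvq hK hCas hP hc hinf κ hκ γ _ 𝔭 h𝔭 he hf
  have hpN : p ∣ W.conductorNorm ℤ := dvd_conductorNorm_of_mult hE.2.1
  have hsplit : SplitsIn K p := hK.2.2.1 p (Fact.out : p.Prime) hpN (Ne.symm hqp)
  have hp2 : p ≠ 2 := by have h5 := hE.1; omega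
  obtain ⟨h6, h9, h10⟩ := hPT q K Dt H ι P hE hr hqp hmq hns hvq hK hCas hP hc hinf κ hκ γ 𝔭 h𝔭 he hf
  exact controlOnTreeAt_of_atoms hE hK.1 hsplit hκ γ 𝔭 h𝔭 he hf (embAt K p 𝔭 h𝔭 he hf) P h6 h9 h10
    (r1LocalKernelOrderAt_of_anticyclotomicDecomposition W p hBr hp2 K hK.1 κ hκ)

/-! ## Statement of record -/

/-- **Route R1 — STATEMENT OF RECORD, every typed shape "on constructed objects" eliminated.** For
every globally minimal elliptic `W/ℚ` and prime `p` on `R1Population` with `ord_{s=1} L(E,s) = 1`: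
`BSD(E,p)`, from the NINE PUBLISHED named facts of `R1.bsdp` (Gross–Zagier 1986 I.7.3;
Gross–Zagier–Kolyvagin over `ℚ`; Skinner 2016 Thm. C; modularity; Cai–Shu–Tian 2014 Thm. 1.1;
Friedberg–Hoffstein, ramified form; Mazur 1978 on the Manin constant; Néron scaling), FIVE CITED facts
taken as hypotheses (Poitou–Tate duality for Selmer structures, Howard 2.1.11 / Milne I 4.10(b);
Poitou–Tate duality of `Ш`, Harari 17.13(b) / Milne I 4.10(a); Tate's local Euler–Poincaré
characteristic, Milne I 2.8; `cd_p(Γ_K) ≤ 2`, Serre II §4.4 Prop. 13; Brink 2007 Thm. 2 / Cor. 1: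
split primes are finitely decomposed in the anticyclotomic `ℤ_p`-extension), and the ONE OPEN input
`R1OpenInputOnTreeAt` ((IMC)∘(BDP) at `𝟙`: erratum Thm. 1.1 ⇐ [FW21, Thm. 4.41], PREPRINT, composed
with Cas18 Thm. 3.2). Everything else — Castella 2018 Thm. 2.3 (the anticyclotomic control theorem,
all four JSW17 §3 atoms (P6), (P9), (L10), (P11) on route R1's constructed `Sel_𝔭^Σ(K_∞, E[p^∞])`),
Castella §5 ((TAM-q), (B), (C), twist transport, the Heegner point, the Manin package), erratum
Lemma 2.1 and the Thm. 1.1 ⇐ Thm. 2.3 step — is a tree theorem. CONDITIONAL; deletes nothing; X11b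
stays CONSTRUCTION-SHAPED; no label change. [cite: Castella2018, Thm. 2.3 and §5 (arXiv:1704.06608 pp. 5, 12)]
[cite: Castella2018Erratum, Thm. 1.1, Thm. A′ (p. 1)]
[cite: JetchevSkinnerWan2017, Prop. 3.2.1, Thm. 3.3.1, Prop. 3.3.2, Lemma 3.3.3, Prop. 3.3.4 (arXiv:1512.06894 pp. 10–13)]
[cite: Brink2007, Thm. 2 and Cor. 1 (pp. 2134–2136)] -/
theorem R1.bsdp_of_onTree_final
    (hGZ : GrossZagier1986_thm_I_7_3) (hGZK : rank_eq_analyticRank_of_analyticRank_le_one)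
    (hSk : Skinner2016.thmC_padicValRat_bsd_rank_zero) (hmod : exists_isNewformOf)
    (hCST : CaiShuTian2014.thm11_trivialChar)
    (hFH : friedbergHoffstein_exists_twist_ne_zero_ramifiedAt)
    (hMaz : mazur_not_dvd_maninConstant_of_odd) (hNS : integral_neronScaling_of_isGloballyMinimal)
    (hPT : ∀ (K : Type) [Field K] [NumberField K], poitouTate_selmerStructure_duality K)
    (hPT2 : ∀ (K : Type) [Field K] [NumberField K], poitouTate_sha_tateDual K)
    (hEP : ∀ (K : Type) [Field K] [NumberField K] (v : HeightOneSpectrum (𝓞 K)),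
      localEulerPoincareCharacteristic (v.adicCompletion K))
    (hcd : fieldCdLE_two_of_numberField)
    (hBr : ∀ (K : Type) [Field K] [NumberField K] (p : ℕ) [Fact p.Prime],
      ZpExtension.decomp_not_le_kerSubgroup_of_isAnticyclotomic K p)
    (hA : ∀ (W : WeierstrassCurve ℚ) [W.IsElliptic] [W.IsGloballyMinimal] (p : ℕ) [Fact p.Prime],
      R1OpenInputOnTreeAt W p)
    (hW : R1Population W p) (hr : W.analyticRank = 1) : BSDp W p :=
  R1.bsdp_of_onTree hGZ hGZK hSk hmod hCST hFH hMaz hNS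
    (fun W _ _ p _ ↦ r1ControlOnTreeAt_of_poitouTateAtoms_of_anticyclotomicDecomposition W p hBr
      (r1PoitouTateAtomsAt_of_twoAtoms W p hPT hEP
        (r1TwoAtomsAt_of_baseSelmerCount W p hPT hPT2 hEP hcd
          (r1BaseSelmerCountAt_of_facts W p hGZK hmod hPT hEP))))
    hA W p hW hr

end ClassLevel

end Summit.BirchSwinnertonDyer.Rank1Residual.X11b

end
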